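import Mathlib

/-!
# Sketch — crux-ideate stmt-HodgeConjecture-13674 (TwinSimilitudeAlgebraic), ideator 2
First lemmas of the line `lagrangian-bicover-transport` (pure linear algebra, Mathlib only).

Setting: `VS`, `VS'`, `VZ` model `H²(S;ℚ)`, `H²(S';ℚ)`, `H²(Z̃;ℚ)` with their cup forms
`BS`, `BS'`, `BZ`; `pstar = p^*`, `qstar = q^*` for the two projections of a Lagrangian
correspondence `Z̃ → S × S'` of bidegree `(a, b)`; `ψ : H²(S') → H²(S)` the twin 2-similitude.
-/

namespace Summit.HodgeConjecture.HodgeConjecture.Cruxes.TwinSimilitudeAlgebraic.LagrangianBicover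

variable {VS VS' VZ : Type*} [AddCommGroup VS] [Module ℚ VS] [AddCommGroup VS'] [Module ℚ VS']
  [AddCommGroup VZ] [Module ℚ VZ]

/-- BIDEGREE LAW. If `p^*` has multiplier `a`, `q^*` has multiplier `b`, `ψ` has multiplier `2`,
and the commensurability `p^* ∘ ψ = c • q^*` holds (the cohomological form of "full twin Hodge
locus" for a Lagrangian correspondence), then `(2a - c²b) · BS' = 0`; for a non-zero form,
`2a = c² b`, i.e. `ab ∈ 2·ℚ^{×2}` — bidegree `(1,2)` is Nikulin, the minimal general one is `(2,4)`. -/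
def BidegreeLaw : Prop :=
  ∀ (BS : VS →ₗ[ℚ] VS →ₗ[ℚ] ℚ) (BS' : VS' →ₗ[ℚ] VS' →ₗ[ℚ] ℚ) (BZ : VZ →ₗ[ℚ] VZ →ₗ[ℚ] ℚ)
    (pstar : VS →ₗ[ℚ] VZ) (qstar : VS' →ₗ[ℚ] VZ) (ψ : VS' →ₗ[ℚ] VS) (a b c : ℚ),
    (∀ x y, BZ (pstar x) (pstar y) = a * BS x y) →
    (∀ u v, BZ (qstar u) (qstar v) = b * BS' u v) →
    (∀ u v, BS (ψ u) (ψ v) = 2 * BS' u v) →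
    (∀ u, pstar (ψ u) = c • qstar u) →
    ∀ u v, (2 * a - c ^ 2 * b) * BS' u v = 0

theorem bidegreeLaw : (BidegreeLaw (VS := VS) (VS' := VS') (VZ := VZ)) := by
  intro BS BS' BZ pstar qstar ψ a b c hp hq hψ hc u v
  have h1 : BZ (pstar (ψ u)) (pstar (ψ v)) = a * (2 * BS' u v) := by rw [hp, hψ]
  have h2 : BZ (pstar (ψ u)) (pstar (ψ v)) = c ^ 2 * (b * BS' u v) := by
    simp only [hc, map_smul, LinearMap.smul_apply, smul_eq_mul, hq]; ring
  linear_combination h2 - h1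

/-- CORRESPONDENCE ACTION. With `pT = p_*` the `BS/BZ`-adjoint of `p^*`, commensurability makes the
correspondence `[Z̃]^* = p_* q^*` act on `H²(S')` with multiplier `a * b` relative to `BS'`
(so `[Z̃]^*` is `(a/c)·ψ`: an honest multiple of the twin similitude, no ballast). -/
def CorrespondenceMultiplier : Prop :=
  ∀ (BS : VS →ₗ[ℚ] VS →ₗ[ℚ] ℚ) (BS' : VS' →ₗ[ℚ] VS' →ₗ[ℚ] ℚ) (BZ : VZ →ₗ[ℚ] VZ →ₗ[ℚ] ℚ)
    (pstar : VS →ₗ[ℚ] VZ) (pT : VZ →ₗ[ℚ] VS) (qstar : VS' →ₗ[ℚ] VZ) (ψ : VS' →ₗ[ℚ] VS) (a b c : ℚ),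
    (∀ x y, BZ (pstar x) (pstar y) = a * BS x y) →
    (∀ z x, BS (pT z) x = BZ z (pstar x)) →
    (∀ x z, BS x (pT z) = BZ (pstar x) z) →
    (∀ u v, BZ (qstar u) (qstar v) = b * BS' u v) →
    (∀ u, c • qstar u = pstar (ψ u)) → c ≠ 0 →
    ∀ u v, BS (pT (qstar u)) (pT (qstar v)) = (a * b) * BS' u v

end Summit.HodgeConjecture.HodgeConjecture.Cruxes.TwinSimilitudeAlgebraic.LagrangianBicover
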